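import Summits.Ventures.QEC.Thresholds.ToricCodeXSectorThresholds
import Summits.Ventures.QEC.Thresholds.ToricCodeThresholdKernelPT
import HarnessLib

/-!
# Toric code, best KERNEL constants in both sectors and under depolarizing noise: `p_c^X > .0348`,
# `p_c^depol > .0522` (from qec-type-03's kernel-checked Pönitz–Tittmann bound `μ(ℤ²) ≤ 2.7248`)

Venture QEC, `Summits/Ventures/QEC/Thresholds/` (LADDER-QEC rung Q5, PARTITION row 09; qec-type-09 gen 3). The transfer
principle `toric_x_isThresholdLowerBound_of_z` (lattice duality, `ToricCodeXSectorThresholds.lean`) and the `3/2` rule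
(`DepolarizingThresholds.lean`) applied to the cell's best KERNEL `Z`-sector constant, qec-type-03's
`toricThreshold_kernelK10 : IsThresholdLowerBound (toricFailureFamily D) (thresholdValue 2.7248)`
(`ToricCodeThresholdKernelPT.lean`, memory-10 transfer-matrix certificate, `decide` in the kernel):

* `toric_x_isThresholdLowerBound_kernelK10` — `X`-sector (bit flips, plaquette syndrome) threshold `≥ p₀(2.7248)` for every
  minimum-weight decoder family; decimal `toric_x_accuracyThreshold_gt_0348`;
* `toric_depolarizing_isThresholdLowerBound_kernelK10` — depolarizing threshold `≥ (3/2)·p₀(2.7248) ≈ .0523` for every pair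
  of minimum-weight decoder families (sector-wise decoding); decimal `toric_depolarizing_accuracyThreshold_gt_0522`;
  canonical instance.

UNCONDITIONAL, kernel axioms, no named fact, no `native_decide`. HONEST FRAMING as in the two packaged files: sector-wise
(correlation-blind) minimum-weight decoding; the `3/2` is the exact marginal conversion; numerics are VALIDATED-column.

## References

* [DennisEtAl2002] E. Dennis, A. Kitaev, A. Landahl, J. Preskill, J. Math. Phys. 43 (2002) 4452, §3.1, §4.1, §5.3.
-/

noncomputable section

namespace Summit.Ventures.QEC.Thresholds

open Filter Topology Finset Matrix
open Literature.InformationTheory.QuantumCodes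
open Literature.InformationTheory.QuantumCodes.ToricCode

/-- **`X`-sector toric threshold `≥ p₀(2.7248)`** (kernel-checked memory-10 walk bound + lattice duality), every
minimum-weight decoder family of the plaquette syndrome. UNCONDITIONAL. [cite: DennisEtAl2002, §5.3 eqs. (saw_2), (threshold_2d)] -/
theorem toric_x_isThresholdLowerBound_kernelK10 (DX : (L : ℕ) → Decoder (Syndrome (L + 1)) (Chain (L + 1)))
    (hDX : ∀ L, (DX L).IsMinWeight (toricCode (L + 1)).xSyndrome
      ((toricCode (L + 1)).kerZ : Set (Chain (L + 1))) hammingNorm) :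
    IsThresholdLowerBound (xFailureFamily (fun L => toricCode (L + 1)) DX) (thresholdValue 2.7248) :=
  toric_x_isThresholdLowerBound_of_z (fun _ hD => toricThreshold_kernelK10 hD) DX hDX

/-- **`p_c^X > .0348`** (decimal, kernel) for bit flips on the toric code. [cite: DennisEtAl2002, §5.3 eq. (p_c_2d)] -/
theorem toric_x_accuracyThreshold_gt_0348 (DX : (L : ℕ) → Decoder (Syndrome (L + 1)) (Chain (L + 1)))
    (hDX : ∀ L, (DX L).IsMinWeight (toricCode (L + 1)).xSyndrome
      ((toricCode (L + 1)).kerZ : Set (Chain (L + 1))) hammingNorm) :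
    (0.0348 : ℝ) < accuracyThreshold (xFailureFamily (fun L => toricCode (L + 1)) DX) :=
  lt_of_lt_of_le thresholdValue_27248_bounds.1
    (le_accuracyThreshold (toric_x_isThresholdLowerBound_kernelK10 DX hDX)
      ((thresholdValue_le_half _).trans (by norm_num)))

/-- **Depolarizing toric threshold `≥ (3/2)·p₀(2.7248) ≈ .0523`**, sector-wise minimum-weight decoding (any pair of
minimum-weight decoder families). UNCONDITIONAL, kernel. [cite: DennisEtAl2002, §4.1 (depolarizing channel vs. independent X/Z errors)] -/
theorem toric_depolarizing_isThresholdLowerBound_kernelK10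
    (DX : (L : ℕ) → Decoder (Syndrome (L + 1)) (Chain (L + 1))) (DZ : (L : ℕ) → ZDecoder (L + 1))
    (hDX : ∀ L, (DX L).IsMinWeight (toricCode (L + 1)).xSyndrome
      ((toricCode (L + 1)).kerZ : Set (Chain (L + 1))) hammingNorm)
    (hDZ : ∀ L, (DZ L).IsMinWeight (syn (L + 1)) (cycles (L + 1)) hammingNorm) :
    IsThresholdLowerBound (depolarizingFailureFamily (fun L => toricCode (L + 1)) DX DZ)
      (3 / 2 * thresholdValue 2.7248) := by
  have hZ : IsThresholdLowerBound (zFailureFamily (fun L => toricCode (L + 1)) DZ) (thresholdValue 2.7248) := by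
    rw [zFailureFamily_toricCode]
    exact toricThreshold_kernelK10 hDZ
  have h := depolarizing_isThresholdLowerBound (fun L => toricCode (L + 1)) DX DZ
    (toric_x_isThresholdLowerBound_kernelK10 DX hDX) hZ ((min_le_left _ _).trans (thresholdValue_le_two_thirds _))
  rwa [min_self] at h

/-- **`p_c^depol > .0522`** (decimal, kernel) for the toric code under sector-wise minimum-weight decoding.
[cite: DennisEtAl2002, §4.1 and §5.3] -/
theorem toric_depolarizing_accuracyThreshold_gt_0522
    (DX : (L : ℕ) → Decoder (Syndrome (L + 1)) (Chain (L + 1))) (DZ : (L : ℕ) → ZDecoder (L + 1))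
    (hDX : ∀ L, (DX L).IsMinWeight (toricCode (L + 1)).xSyndrome
      ((toricCode (L + 1)).kerZ : Set (Chain (L + 1))) hammingNorm)
    (hDZ : ∀ L, (DZ L).IsMinWeight (syn (L + 1)) (cycles (L + 1)) hammingNorm) :
    (0.0522 : ℝ) < accuracyThreshold (depolarizingFailureFamily (fun L => toricCode (L + 1)) DX DZ) := by
  have h := thresholdValue_27248_bounds.1
  refine lt_of_lt_of_le (by linarith)
    (le_accuracyThreshold (toric_depolarizing_isThresholdLowerBound_kernelK10 DX DZ hDX hDZ) ?_)
  have := thresholdValue_le_half (2.7248 : ℝ)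
  linarith

/-- Canonical instance: minimum-weight decoding of both syndromes — depolarizing threshold `≥ (3/2)·p₀(2.7248)`.
UNCONDITIONAL. [cite: DennisEtAl2002, §4.1 and §5.1] -/
theorem toric_depolarizing_isThresholdLowerBound_kernelK10_minWeight :
    IsThresholdLowerBound
      (depolarizingFailureFamily (fun L => toricCode (L + 1))
        (fun L => Decoder.minWeight (toricCode (L + 1)).xSyndrome hammingNorm)
        fun L => Decoder.minWeight (syn (L + 1)) hammingNorm)
      (3 / 2 * thresholdValue 2.7248) :=
  toric_depolarizing_isThresholdLowerBound_kernelK10 _ _ toric_isMinWeight_minWeight_x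
    fun L => ToricCode.isMinWeight_minWeight (L + 1)

end Summit.Ventures.QEC.Thresholds
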